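import Literature.NumberTheory.LFunctions.SmoothedExplicitFormulaContour
import HarnessLib

/-!
# The smoothed explicit formula of Heath-Brown, Ford and Kadiri, III: the left line in Kadiri's form

Topic `Literature/NumberTheory/LFunctions`. Everything in this file is PROVED (no named fact).
Third file of the in-tree proof of the smoothed explicit formula
(`SmoothedExplicitFormulaPrimeSide.lean`, `SmoothedExplicitFormulaContour.lean`). The exact formula
`K_f(s) = −f(0)ζ'/ζ(s) + F₀(s−1) − Σ_ρ m(ρ)F₀(s−ρ) + J(s)` (`SmoothedEF.fordK_eq_explicit`) has the
remainder `J(s) = (1/2πi)∫_{(−1/2)} (−ζ'/ζ)(w) F₀(s−w) dw`. Kadiri (2005, proof of Thm. 3.1,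
(3.3)–(3.5)) transforms this line integral by the functional equation
`−ζ'/ζ(w) = ζ'/ζ(1−w) − log π + ½[ψ(w/2) + ψ((1−w)/2)]`:

* the `ζ'/ζ(1−w) = −Σ Λ(n) n^{w−1}` piece and the `−log π` piece integrate to `0` against
  `F₀(s − w)` (Kadiri's (3.3)–(3.4): `Σ Λ(n)/n · φ(−log n) = 0` and `φ(0) log(1/π) = 0` for her
  `φ`, which vanishes on `(−∞, 0]`); here by **Mellin inversion on a line `Re u > 0`**, where `F₀`
  is the Mellin transform of `t ↦ f(max(−log t,0)) − f(0)`, a function vanishing on `[1, ∞)`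
  (`SmoothedEF.integral_cpow_neg_mul_fordLaplace₀_eq_zero`);
* the digamma piece is moved to the line `Re w = 1/2` across the pole of `ψ(w/2)` at `w = 0`
  (residue `−F₀(s)`; Kadiri's (3.5) "`+ (1−𝔞)Φ(0)`"), where `½[ψ(w/2) + ψ((1−w)/2)] = Re ψ(w/2)`.

Result (`Literature.NumberTheory.LFunctions.SmoothedEF.smoothedEFRemainder_eq_kadiri`): for an
admissible smoothing and `1/2 < Re s < 3/2`,
`J(s) = F₀(s) + (1/2π) ∫_ℝ Re ψ((1/2+iy)/2) · F₀(s − 1/2 − iy) dy`,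
which with `SmoothedEF.fordK_eq_explicit` is the complex form of Kadiri's (2.2)/Prop. 2.1
(`Literature.NumberTheory.LFunctions.SmoothedEF.fordK_eq_explicit_kadiri`).

## References

* H. Kadiri, *Une région explicite sans zéros pour la fonction ζ de Riemann*, Acta Arith. 117
  (2005) = arXiv:math/0401238, Thm. 3.1 and its proof, (3.1)–(3.5), and the derivation of (2.2)
  from it (§3.1, end). (`Kadiri2005`)
* K. Ford, *Zero-free regions for the Riemann zeta function* (2002) = arXiv:1910.08205, Lemma 4.5.
  (`Ford2002Millennium`)
-/

noncomputable section

open Complex Real MeasureTheory Set Filter Topology Asymptotics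
open scoped ComplexConjugate

namespace Literature.NumberTheory.LFunctions

namespace SmoothedEF

variable {f p p' p'' : ℝ → ℝ} {x₀ : ℝ}

/-! ## The Mellin pair on `Re u > 0`: `F₀` is the transform of `t ↦ f(max(−log t,0)) − f(0)` -/

/-- The lift of `y ↦ f(y) − f(0)` is the lift of `f` minus `f(0)`. [folklore] -/
theorem smoothedEFLift_sub_const (f : ℝ → ℝ) (t : ℝ) :
    smoothedEFLift (fun y ↦ f y - f 0) t = smoothedEFLift f t - (f 0 : ℂ) := by
  simp [smoothedEFLift]

/-- A continuous `f` vanishing on `[x₀, ∞)` is bounded on `[0, ∞)`. [folklore] -/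
theorem exists_bound_of_eq_zero (hfc : Continuous f) (hf0 : ∀ u, x₀ ≤ u → f u = 0) :
    ∃ B : ℝ, ∀ y, 0 ≤ y → |f y| ≤ B := by
  obtain ⟨C, hC⟩ := isCompact_Icc.exists_bound_of_continuousOn (hfc.continuousOn (s := Icc 0 x₀))
  refine ⟨max C 0, fun y hy ↦ ?_⟩
  by_cases hyx : y ≤ x₀
  · exact (le_max_left _ _).trans' (by simpa [Real.norm_eq_abs] using hC y ⟨hy, hyx⟩)
  · rw [hf0 y (le_of_not_ge hyx), abs_zero]
    exact le_max_right _ _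

/-- For `Re u > 0` the Mellin transform of `t ↦ f(max(−log t,0)) − f(0)` converges absolutely
(the function is bounded near `0` and vanishes on `[1, ∞)`). [folklore] -/
theorem mellinConvergent_smoothedEFLift_sub (hfc : Continuous f) (hf0 : ∀ u, x₀ ≤ u → f u = 0)
    {u : ℂ} (hu : 0 < u.re) : MellinConvergent (smoothedEFLift (fun y ↦ f y - f 0)) u := by
  obtain ⟨B, hB⟩ := exists_bound_of_eq_zero hfc hf0
  refine mellinConvergent_of_isBigO_rpow (a := u.re + 1) (b := 0)
    ((continuousOn_smoothedEFLift (by fun_prop)).locallyIntegrableOn measurableSet_Ioi) ?_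
    (by linarith) ?_ (by simpa using hu)
  · refine IsBigO.of_bound 0 ?_
    filter_upwards [Ici_mem_atTop (1 : ℝ)] with t ht
    rw [smoothedEFLift_of_one_le _ ht]
    simp
  · refine IsBigO.of_bound (B + |f 0|) ?_
    filter_upwards [self_mem_nhdsWithin] with t _
    rw [neg_zero, Real.rpow_zero, Real.norm_eq_abs, abs_one, mul_one, smoothedEFLift]
    have h1 : |f (max (-Real.log t) 0)| ≤ B := hB _ (le_max_right _ _)
    rw [show ((fun y ↦ f y - f 0) (max (-Real.log t) 0) : ℂ) =
      ((f (max (-Real.log t) 0) - f 0 : ℝ) : ℂ) by push_cast; rfl, Complex.norm_real, Real.norm_eq_abs]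
    exact (abs_sub _ _).trans (by linarith)

/-- **`mellin (lift (f − f(0))) (u) = F₀(u)` for `Re u > 0`**: `∫_0^∞ (f(y) − f(0)) e^{-uy} dy =
F(u) − f(0)/u`. [folklore] -/
theorem mellin_smoothedEFLift_sub (hfc : Continuous f) (hf0 : ∀ u, x₀ ≤ u → f u = 0)
    (hx₀ : 0 ≤ x₀) {u : ℂ} (hu : 0 < u.re) :
    mellin (smoothedEFLift (fun y ↦ f y - f 0)) u = fordLaplace₀ f u := by
  rw [mellin_smoothedEFLift_eq_integral]
  have h1 : IntegrableOn (fun y : ℝ ↦ Complex.exp (-(u * y)) * (f (max y 0) : ℂ)) (Ioi 0) :=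
    integrableOn_Ioi_smoothedEF hfc hf0 hx₀ u
  have h2 : IntegrableOn (fun y : ℝ ↦ Complex.exp (-(u * y)) * (f 0 : ℂ)) (Ioi 0) := by
    have := (integrableOn_exp_mul_complex_Ioi (a := -u) (by simpa using hu) 0).mul_const (f 0 : ℂ)
    refine IntegrableOn.congr_fun this (fun y _ ↦ ?_) measurableSet_Ioi
    simp [neg_mul]
  have hIic : IntegrableOn (fun y : ℝ ↦ Complex.exp (-(u * y)) *
      (((fun y ↦ f y - f 0) (max y 0) : ℝ) : ℂ)) (Iic 0) := by
    refine integrableOn_zero.congr_fun (fun y hy ↦ ?_) measurableSet_Iic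
    rw [mem_Iic] at hy
    simp [max_eq_right hy]
  have hIoi : IntegrableOn (fun y : ℝ ↦ Complex.exp (-(u * y)) *
      (((fun y ↦ f y - f 0) (max y 0) : ℝ) : ℂ)) (Ioi 0) := by
    refine (h1.sub h2).congr_fun (fun y _ ↦ ?_) measurableSet_Ioi
    simp only [Pi.sub_apply]
    push_cast
    ring
  rw [← intervalIntegral.integral_Iic_add_Ioi hIic hIoi]
  have e0 : ∫ y in Iic (0 : ℝ), Complex.exp (-(u * y)) * (((fun y ↦ f y - f 0) (max y 0) : ℝ) : ℂ) = 0 :=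
    setIntegral_eq_zero_of_forall_eq_zero fun y hy ↦ by
      rw [mem_Iic] at hy
      simp [max_eq_right hy]
  have e1 : ∫ y in Ioi (0 : ℝ), Complex.exp (-(u * y)) * (f (max y 0) : ℂ) = fordLaplace f u := by
    unfold fordLaplace
    refine setIntegral_congr_fun measurableSet_Ioi fun y hy ↦ ?_
    rw [mem_Ioi] at hy
    simp [max_eq_left hy.le]
  have e2 : ∫ y in Ioi (0 : ℝ), Complex.exp (-(u * y)) * (f 0 : ℂ) = (f 0 : ℂ) / u := by
    have hu0 : u ≠ 0 := fun h ↦ by rw [h] at hu; simp at hu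
    have := integral_exp_mul_complex_Ioi (a := -u) (by simpa using hu) 0
    rw [setIntegral_congr_fun measurableSet_Ioi (g := fun y : ℝ ↦ Complex.exp (-u * y) * (f 0 : ℂ))
      (fun y _ ↦ by simp [neg_mul]), integral_mul_const, this]
    simp only [ofReal_zero, mul_zero, Complex.exp_zero]
    field_simp
  have e3 : ∫ y in Ioi (0 : ℝ), Complex.exp (-(u * y)) * (((fun y ↦ f y - f 0) (max y 0) : ℝ) : ℂ) =
      fordLaplace f u - (f 0 : ℂ) / u := by
    rw [← e1, ← e2, ← integral_sub h1 h2]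
    refine setIntegral_congr_fun measurableSet_Ioi fun y _ ↦ ?_
    push_cast
    ring
  rw [e0, e3, zero_add, fordLaplace₀]

/-- **Mellin inversion on a line `Re u = c > 0`**: for `n ≥ 1`,
`∫_ℝ n^{-(c+iy)} F₀(c+iy) dy = 0` (the inverse transform at `x = n ≥ 1` is
`f(max(−log n, 0)) − f(0) = 0`). This is Kadiri's "`Σ Λ(n)χ̄(n)/n · φ(−log n)`" and "`φ(0) log(q/π)`"
vanishing for her `φ` supported on `[0, ∞)` with `φ(0) = 0`. [cite: Kadiri2005, (3.3)–(3.4)] -/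
theorem integral_cpow_neg_mul_fordLaplace₀_eq_zero (hfc : Continuous f) (hf0 : ∀ u, x₀ ≤ u → f u = 0)
    (hx₀ : 0 ≤ x₀) {c : ℝ} (hc : 0 < c) (hint : Integrable fun y : ℝ ↦ fordLaplace₀ f (c + y * I))
    {n : ℕ} (hn : 1 ≤ n) :
    ∫ y : ℝ, (n : ℂ) ^ (-((c : ℂ) + y * I)) * fordLaplace₀ f (c + y * I) = 0 := by
  have hx : (0 : ℝ) < (n : ℝ) := by exact_mod_cast hn
  set k : ℝ → ℝ := fun y ↦ f y - f 0 with hk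
  have hmel : ∀ y : ℝ, mellin (smoothedEFLift k) (c + y * I) = fordLaplace₀ f (c + y * I) :=
    fun y ↦ mellin_smoothedEFLift_sub hfc hf0 hx₀ (by simpa using hc)
  have hconv : MellinConvergent (smoothedEFLift k) c :=
    mellinConvergent_smoothedEFLift_sub hfc hf0 (by simpa using hc)
  have hvert : VerticalIntegrable (mellin (smoothedEFLift k)) c := by
    unfold VerticalIntegrable
    exact hint.congr (Eventually.of_forall fun y ↦ (hmel y).symm)
  have hkc : Continuous k := by rw [hk]; fun_prop
  have key := mellinInv_mellin_eq c (smoothedEFLift k) hx hconv hvert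
    (continuousAt_smoothedEFLift hkc hx)
  have hval : smoothedEFLift k (n : ℝ) = 0 := by
    rw [smoothedEFLift_of_one_le k (by exact_mod_cast hn : (1 : ℝ) ≤ n)]
    simp [hk]
  rw [hval, mellinInv] at key
  simp_rw [hmel, smul_eq_mul, Complex.real_smul, ofReal_natCast] at key
  rcases mul_eq_zero.1 key with h | h
  · exact absurd h (by norm_num [Real.pi_ne_zero])
  · exact h

/-! ## The two vanishing pieces of the left line -/

section vanishing

variable {s : ℂ}

/-- `∫_ℝ F₀(s + 1/2 − iy) dy = 0` (`Re s > −1/2`): the `−log π` piece of Kadiri's decomposition.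
[cite: Kadiri2005, (3.3)] -/
theorem integral_fordLaplace₀_left_eq_zero (h : IsSmoothedEFTest f p p' p'' x₀) (hσ₁ : -(1 / 2) < s.re) :
    ∫ y : ℝ, fordLaplace₀ f (s - ((((-(1 / 2) : ℝ)) : ℂ) + y * I)) = 0 := by
  set c : ℝ := s.re + 1 / 2 with hc
  have hc0 : 0 < c := by rw [hc]; linarith
  have hint := integrable_vertical h hc0.ne'
  have harg : ∀ y : ℝ, s - ((((-(1 / 2) : ℝ)) : ℂ) + y * I) = (c : ℂ) + ((s.im - y : ℝ) : ℂ) * I := by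
    intro y; apply Complex.ext <;> simp [hc]
  simp_rw [harg]
  rw [integral_sub_left_eq_self (fun y : ℝ ↦ fordLaplace₀ f (c + y * I)) volume s.im]
  have h1 := integral_cpow_neg_mul_fordLaplace₀_eq_zero h.cont h.eq_zero h.x₀_nonneg hc0 hint le_rfl
  simpa using h1

/-- The `n`-th dual term: `∫_ℝ n^{−(3/2 − iy)} F₀(s + 1/2 − iy) dy = 0` (`n ≥ 1`). [folklore] -/
theorem integral_cpow_dual_mul_fordLaplace₀_eq_zero (h : IsSmoothedEFTest f p p' p'' x₀)
    (hσ₁ : -(1 / 2) < s.re) {n : ℕ} (hn : 1 ≤ n) :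
    ∫ y : ℝ, (n : ℂ) ^ (-((((3 / 2 : ℝ)) : ℂ) - y * I)) *
      fordLaplace₀ f (s - ((((-(1 / 2) : ℝ)) : ℂ) + y * I)) = 0 := by
  set c : ℝ := s.re + 1 / 2 with hc
  have hc0 : 0 < c := by rw [hc]; linarith
  have hint := integrable_vertical h hc0.ne'
  have hn0 : (n : ℂ) ≠ 0 := by exact_mod_cast (by omega : n ≠ 0)
  set G : ℝ → ℂ := fun v ↦ (n : ℂ) ^ (-(((3 / 2 : ℝ)) : ℂ) + s.im * I + c + -((c : ℂ) + v * I)) *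
    fordLaplace₀ f (c + v * I) with hG
  have h1 : ∀ y : ℝ, (n : ℂ) ^ (-((((3 / 2 : ℝ)) : ℂ) - y * I)) *
      fordLaplace₀ f (s - ((((-(1 / 2) : ℝ)) : ℂ) + y * I)) = G (s.im - y) := by
    intro y
    have harg : s - ((((-(1 / 2) : ℝ)) : ℂ) + y * I) = (c : ℂ) + ((s.im - y : ℝ) : ℂ) * I := by
      apply Complex.ext <;> simp [hc]
    have hexp : -((((3 / 2 : ℝ)) : ℂ) - y * I) =
        -(((3 / 2 : ℝ)) : ℂ) + s.im * I + c + -((c : ℂ) + ((s.im - y : ℝ) : ℂ) * I) := by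
      push_cast; ring
    simp only [hG, harg, hexp]
  simp_rw [h1]
  rw [integral_sub_left_eq_self G volume s.im]
  have h2 : ∀ v : ℝ, G v = (n : ℂ) ^ (-(((3 / 2 : ℝ)) : ℂ) + s.im * I + c) *
      ((n : ℂ) ^ (-((c : ℂ) + v * I)) * fordLaplace₀ f (c + v * I)) := by
    intro v
    simp only [hG]
    rw [cpow_add _ _ hn0, mul_assoc]
  simp_rw [h2]
  rw [integral_const_mul, integral_cpow_neg_mul_fordLaplace₀_eq_zero h.cont h.eq_zero h.x₀_nonneg
    hc0 hint hn, mul_zero]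

/-- **The dual prime side vanishes**: `∫_ℝ (Σ Λ(n) n^{−(3/2−iy)}) F₀(s + 1/2 − iy) dy = 0`, i.e. the
`ζ'/ζ(1−w)` piece of the functional equation on `Re w = −1/2` contributes nothing
(Kadiri's (3.4) with `φ(−log n) = 0`). [cite: Kadiri2005, (3.4)] -/
theorem integral_LSeries_dual_mul_fordLaplace₀_eq_zero (h : IsSmoothedEFTest f p p' p'' x₀)
    (hσ₁ : -(1 / 2) < s.re) :
    Integrable (fun y : ℝ ↦ LSeries (fun n ↦ ((ArithmeticFunction.vonMangoldt n : ℝ) : ℂ))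
        ((((3 / 2 : ℝ)) : ℂ) - y * I) * fordLaplace₀ f (s - ((((-(1 / 2) : ℝ)) : ℂ) + y * I))) ∧
      ∫ y : ℝ, LSeries (fun n ↦ ((ArithmeticFunction.vonMangoldt n : ℝ) : ℂ))
        ((((3 / 2 : ℝ)) : ℂ) - y * I) * fordLaplace₀ f (s - ((((-(1 / 2) : ℝ)) : ℂ) + y * I)) = 0 := by
  set c : ℝ := s.re + 1 / 2 with hc
  have hc0 : 0 < c := by rw [hc]; linarith
  have hint := integrable_vertical h hc0.ne'
  -- integrability of `y ↦ F₀(s − w(y))`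
  have hF : Integrable fun y : ℝ ↦ fordLaplace₀ f (s - ((((-(1 / 2) : ℝ)) : ℂ) + y * I)) := by
    have harg : ∀ y : ℝ, s - ((((-(1 / 2) : ℝ)) : ℂ) + y * I) = (c : ℂ) + ((s.im - y : ℝ) : ℂ) * I := by
      intro y; apply Complex.ext <;> simp [hc]
    simp_rw [harg]
    exact hint.comp_sub_left s.im
  -- the line `3/2 − iy` has real part `3/2`: the terms are bounded by `Λ(n) n^{-3/2}`
  have hα : (1 : ℝ) < 3 / 2 := by norm_num
  have hnorm : ∀ (n : ℕ) (y : ℝ), ‖LSeries.term (fun n ↦ ((ArithmeticFunction.vonMangoldt n : ℝ) : ℂ))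
      ((((3 / 2 : ℝ)) : ℂ) - y * I) n‖ =
      ‖LSeries.term (fun n ↦ ((ArithmeticFunction.vonMangoldt n : ℝ) : ℂ)) (((3 / 2 : ℝ)) : ℂ) n‖ := by
    intro n y
    simp only [LSeries.norm_term_eq, sub_re, ofReal_re, mul_re, I_re, mul_zero, ofReal_im, I_im,
      mul_one, sub_self, sub_zero]
  have hsumα : Summable fun n ↦ ‖LSeries.term (fun n ↦ ((ArithmeticFunction.vonMangoldt n : ℝ) : ℂ))
      (((3 / 2 : ℝ)) : ℂ) n‖ :=
    summable_norm_iff.mpr (ArithmeticFunction.LSeriesSummable_vonMangoldt (by simp; norm_num))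
  -- continuity and boundedness of `y ↦ L(3/2 − iy)`
  have hLcont : Continuous fun y : ℝ ↦ LSeries (fun n ↦ ((ArithmeticFunction.vonMangoldt n : ℝ) : ℂ))
      ((((3 / 2 : ℝ)) : ℂ) - y * I) := by
    have := (continuous_LSeries_vonMangoldt_vertical hα).comp continuous_neg
    refine this.congr fun y ↦ ?_
    simp only [Function.comp_apply]
    congr 1
    push_cast
    ring
  have hLbdd : ∀ y : ℝ, ‖LSeries (fun n ↦ ((ArithmeticFunction.vonMangoldt n : ℝ) : ℂ))
      ((((3 / 2 : ℝ)) : ℂ) - y * I)‖ ≤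
      ∑' n, ‖LSeries.term (fun n ↦ ((ArithmeticFunction.vonMangoldt n : ℝ) : ℂ)) (((3 / 2 : ℝ)) : ℂ) n‖ := by
    intro y
    have := norm_LSeries_vonMangoldt_vertical_le hα (-y)
    convert this using 3
    push_cast
    ring
  refine ⟨hF.bdd_mul hLcont.aestronglyMeasurable (ae_of_all _ hLbdd), ?_⟩
  -- termwise
  set Fn : ℕ → ℝ → ℂ := fun n y ↦ LSeries.term (fun n ↦ ((ArithmeticFunction.vonMangoldt n : ℝ) : ℂ))
    ((((3 / 2 : ℝ)) : ℂ) - y * I) n * fordLaplace₀ f (s - ((((-(1 / 2) : ℝ)) : ℂ) + y * I)) with hFn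
  have hF_int : ∀ n, Integrable (Fn n) := by
    intro n
    rcases Nat.eq_zero_or_pos n with rfl | hn
    · simp only [hFn, LSeries.term_zero, zero_mul]
      exact integrable_zero _ _ _
    have hn0 : (n : ℂ) ≠ 0 := by exact_mod_cast hn.ne'
    have hcont : Continuous fun y : ℝ ↦ (n : ℂ) ^ (-((((3 / 2 : ℝ)) : ℂ) - y * I)) :=
      (by fun_prop : Continuous fun y : ℝ ↦ -((((3 / 2 : ℝ)) : ℂ) - y * I)).const_cpow (Or.inl hn0)
    have hbdd : ∀ y : ℝ, ‖(n : ℂ) ^ (-((((3 / 2 : ℝ)) : ℂ) - y * I))‖ ≤ (n : ℝ) ^ (-(3 / 2 : ℝ)) := by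
      intro y
      rw [norm_natCast_cpow_of_pos hn]
      simp
    have h := (hF.bdd_mul hcont.aestronglyMeasurable (ae_of_all _ hbdd)).const_mul
      (((ArithmeticFunction.vonMangoldt n : ℝ) : ℂ))
    refine h.congr (Eventually.of_forall fun y ↦ ?_)
    simp only [hFn, LSeries.term_of_ne_zero hn.ne', div_eq_mul_inv, ← cpow_neg]
    ring
  have hF_sum : Summable fun n ↦ ∫ y, ‖Fn n y‖ := by
    have : ∀ n, ∫ y, ‖Fn n y‖ = ‖LSeries.term (fun n ↦ ((ArithmeticFunction.vonMangoldt n : ℝ) : ℂ))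
        (((3 / 2 : ℝ)) : ℂ) n‖ * ∫ y : ℝ, ‖fordLaplace₀ f (s - ((((-(1 / 2) : ℝ)) : ℂ) + y * I))‖ := by
      intro n
      have h' : (fun y : ℝ ↦ ‖Fn n y‖) = fun y : ℝ ↦
          ‖LSeries.term (fun n ↦ ((ArithmeticFunction.vonMangoldt n : ℝ) : ℂ)) (((3 / 2 : ℝ)) : ℂ) n‖ *
            ‖fordLaplace₀ f (s - ((((-(1 / 2) : ℝ)) : ℂ) + y * I))‖ := by
        funext y
        simp only [hFn, norm_mul, hnorm]
      rw [h', integral_const_mul]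
    simp_rw [this]
    exact hsumα.mul_right _
  have hterm : ∀ n, ∫ y, Fn n y = 0 := by
    intro n
    rcases Nat.eq_zero_or_pos n with rfl | hn
    · have h0 : Fn 0 = fun _ ↦ 0 := by
        funext y
        simp only [hFn, LSeries.term_zero, zero_mul]
      rw [h0, integral_zero]
    · have hval := integral_cpow_dual_mul_fordLaplace₀_eq_zero h hσ₁ (Nat.one_le_of_lt hn)
      have h' : Fn n = fun y : ℝ ↦ ((ArithmeticFunction.vonMangoldt n : ℝ) : ℂ) *
          ((n : ℂ) ^ (-((((3 / 2 : ℝ)) : ℂ) - y * I)) *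
            fordLaplace₀ f (s - ((((-(1 / 2) : ℝ)) : ℂ) + y * I))) := by
        funext y
        simp only [hFn, LSeries.term_of_ne_zero hn.ne', div_eq_mul_inv, ← cpow_neg]
        ring
      rw [h', integral_const_mul, hval, mul_zero]
  calc ∫ y : ℝ, LSeries (fun n ↦ ((ArithmeticFunction.vonMangoldt n : ℝ) : ℂ))
        ((((3 / 2 : ℝ)) : ℂ) - y * I) * fordLaplace₀ f (s - ((((-(1 / 2) : ℝ)) : ℂ) + y * I))
      = ∫ y, ∑' n, Fn n y := by
        refine integral_congr_ae (ae_of_all _ fun y ↦ ?_)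
        simp only [hFn, LSeries, tsum_mul_right]
    _ = ∑' n, ∫ y, Fn n y := (integral_tsum_of_summable_integral_norm hF_int hF_sum).symm
    _ = 0 := by simp [hterm]

end vanishing

/-! ## The digamma piece: shift from `Re w = −1/2` to `Re w = 1/2` -/

/-- `P(w) = ½[ψ(w/2 + 1) + ψ((1−w)/2 + 1)]`, the shifted digammas of the functional equation
(`Γ_ℝ'/Γ_ℝ(w) = −½ log π + ½ ψ(w/2 + 1) − 1/w`); analytic on `−2 < Re w < 3`. [folklore] -/
def kadiriP (w : ℂ) : ℂ := (digamma (w / 2 + 1) + digamma ((1 - w) / 2 + 1)) / 2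

/-- `Q_s(w) = (P(w) − 1/w − 1/(1−w)) F₀(s − w) = ½[ψ(w/2) + ψ((1−w)/2)] F₀(s − w)`, the digamma
piece of `(−ζ'/ζ)(w) F₀(s − w)`; its only pole in `−1/2 ≤ Re w ≤ 1/2` (for `Re s > 1/2`) is the
simple pole at `w = 0`, of residue `−F₀(s)`. [folklore] -/
def kadiriQ (f : ℝ → ℝ) (s w : ℂ) : ℂ :=
  (kadiriP w - 1 / w - 1 / (1 - w)) * fordLaplace₀ f (s - w)

/-- `ψ` is differentiable at every point of the right half-plane. [folklore] -/
theorem differentiableAt_digamma {z : ℂ} (hz : 0 < z.re) : DifferentiableAt ℂ digamma z :=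
  Literature.Analysis.SpecialFunctions.Complex.differentiableOn_digamma.differentiableAt
    ((isOpen_lt continuous_const Complex.continuous_re).mem_nhds hz)

/-- `P` is differentiable on `−2 < Re w < 3`. [folklore] -/
theorem differentiableAt_kadiriP {w : ℂ} (h1 : -2 < w.re) (h2 : w.re < 3) :
    DifferentiableAt ℂ kadiriP w := by
  have hz1 : 0 < (w / 2 + 1).re := by simp; linarith
  have hz2 : 0 < ((1 - w) / 2 + 1).re := by simp; linarith
  unfold kadiriP
  refine (((differentiableAt_digamma hz1).comp w ?_).add
    ((differentiableAt_digamma hz2).comp w ?_)).div_const 2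
  · exact (differentiableAt_id.div_const 2).add_const 1
  · exact (((differentiableAt_const 1).sub differentiableAt_id).div_const 2).add_const 1

/-- **`‖P(w)‖ ≤ log(3 + |Im w|) + 8` on `−1/2 ≤ Re w ≤ 1/2`** (logarithmic digamma bound
`‖ψ(z)‖ ≤ log(1+‖z‖) + 8` for `|Im z| ≥ 1/2`, the linear bound `‖ψ(z)‖ ≤ 1 + 3‖z − 1‖` near the
real axis). [folklore] -/
theorem norm_kadiriP_le {w : ℂ} (h1 : -(1 / 2) ≤ w.re) (h2 : w.re ≤ 1 / 2) :
    ‖kadiriP w‖ ≤ Real.log (3 + |w.im|) + 8 := by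
  set z₁ : ℂ := w / 2 + 1 with hz₁
  set z₂ : ℂ := (1 - w) / 2 + 1 with hz₂
  have hz₁re : z₁.re = w.re / 2 + 1 := by simp [hz₁]
  have hz₂re : z₂.re = (1 - w.re) / 2 + 1 := by simp [hz₂]
  have hz₁im : z₁.im = w.im / 2 := by simp [hz₁]
  have hz₂im : z₂.im = -w.im / 2 := by simp [hz₂]
  have hlog3 : 1 ≤ Real.log (3 + |w.im|) := by
    rw [Real.le_log_iff_exp_le (by positivity)]
    linarith [Real.exp_one_lt_d9, abs_nonneg w.im]
  have key : ∀ z : ℂ, 3 / 4 ≤ z.re → z.re ≤ 7 / 4 → |z.im| = |w.im| / 2 →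
      ‖digamma z‖ ≤ Real.log (3 + |w.im|) + 8 := by
    intro z hzr hzr' hzi
    by_cases him : 2 ≤ |w.im|
    · have hhalf : 1 / 2 ≤ |z.im| := by rw [hzi]; linarith
      have hb := Literature.Analysis.SpecialFunctions.Complex.norm_digamma_le_log (by linarith) hhalf
      have hnz : ‖z‖ ≤ 2 + |w.im| := by
        have := Complex.norm_le_abs_re_add_abs_im z
        rw [hzi, abs_of_pos (by linarith : 0 < z.re)] at this
        linarith [abs_nonneg w.im]
      have hlog : Real.log (1 + ‖z‖) ≤ Real.log (3 + |w.im|) :=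
        Real.log_le_log (by positivity) (by linarith)
      linarith
    · push Not at him
      have hb := ZetaZeroSum.norm_digamma_le_linear hzr
      have hnz : ‖z - 1‖ ≤ 7 / 4 := by
        have := Complex.norm_le_abs_re_add_abs_im (z - 1)
        rw [sub_re, sub_im, one_re, one_im, sub_zero, hzi] at this
        have : |z.re - 1| ≤ 3 / 4 := abs_le.2 ⟨by linarith, by linarith⟩
        linarith
      linarith
  have hb1 := key z₁ (by rw [hz₁re]; linarith) (by rw [hz₁re]; linarith) (by rw [hz₁im, abs_div]; norm_num)
  have hb2 := key z₂ (by rw [hz₂re]; linarith) (by rw [hz₂re]; linarith)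
    (by rw [hz₂im, abs_div, abs_neg]; norm_num)
  calc ‖kadiriP w‖ = ‖digamma z₁ + digamma z₂‖ / 2 := by
        rw [kadiriP, norm_div, Complex.norm_two]
    _ ≤ (‖digamma z₁‖ + ‖digamma z₂‖) / 2 := by gcongr; exact norm_add_le _ _
    _ ≤ Real.log (3 + |w.im|) + 8 := by linarith

section digammaShift

variable {s : ℂ}

/-- **The residue of `Q_s` in `[−1/2, 1/2] × [−T, T]`** (`Re s > 1/2`, `T > 0`): the only pole is
`w = 0`, from `½ψ(w/2) = ½ψ(w/2+1) − 1/w`, with residue `−F₀(s)`: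
`∮ Q_s = 2πi · (−F₀(s))`. [folklore] -/
theorem rectBoundaryIntegral_kadiriQ (h : IsSmoothedEFTest f p p' p'' x₀) (hσ₁ : 1 / 2 < s.re)
    {T : ℝ} (hT : 0 < T) :
    Literature.Analysis.Complex.rectBoundaryIntegral (kadiriQ f s) (-(1 / 2)) (1 / 2) (-T) T =
      2 * π * I * (-fordLaplace₀ f s) := by
  classical
  have hab : (-(1 / 2) : ℝ) < 1 / 2 := by norm_num
  have hcd : -T < T := by linarith
  set m : ℝ := min 1 s.re with hm
  have hm12 : 1 / 2 < m := lt_min (by norm_num) hσ₁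
  set U : Set ℂ := {w : ℂ | -1 < w.re ∧ w.re < m} with hU
  have hUopen : IsOpen U :=
    (isOpen_lt continuous_const Complex.continuous_re).inter (isOpen_lt Complex.continuous_re continuous_const)
  have hF₀d : ∀ w ∈ U, DifferentiableAt ℂ (fun w ↦ fordLaplace₀ f (s - w)) w := by
    intro w hw
    have hws : s - w ≠ 0 := by
      intro h0
      have := congrArg Complex.re h0
      simp at this
      linarith [hw.2, min_le_right 1 s.re]
    exact (differentiableAt_fordLaplace₀ h.cont h.x₀_nonneg h.eq_zero hws).comp w
      ((differentiableAt_const _).sub differentiableAt_id)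
  have hPd : ∀ w ∈ U, DifferentiableAt ℂ kadiriP w := fun w hw ↦
    differentiableAt_kadiriP (by linarith [hw.1]) (by linarith [hw.2, min_le_left 1 s.re])
  have hne1 : ∀ w ∈ U, 1 - w ≠ 0 := by
    intro w hw h0
    have := congrArg Complex.re h0
    simp at this
    linarith [hw.2, min_le_left 1 s.re]
  have key := Literature.Analysis.Complex.rectBoundaryIntegral_eq_sum_of_simplePoles hab hcd {0}
    (kadiriQ f s) (fun _ ↦ -fordLaplace₀ f s) U hUopen ?_ ?_ ?_ ?_
  · rw [key, Finset.sum_singleton]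
  · intro w hw
    have h1 := (Complex.mem_reProdIm.1 hw).1
    exact ⟨by linarith [h1.1], by linarith [h1.2]⟩
  · intro p hp
    rw [Finset.coe_singleton, Set.mem_singleton_iff] at hp
    subst hp
    refine ⟨⟨by norm_num, by norm_num⟩, ⟨by simp [hT], by simp [hT]⟩⟩
  · intro w hw
    have hwU : w ∈ U := hw.1
    have hw0 : w ≠ 0 := fun h0 ↦ hw.2 (by simp [h0])
    refine ((((hPd w hwU).sub ((differentiableAt_const _).div differentiableAt_id hw0)).sub
      ((differentiableAt_const _).div ((differentiableAt_const _).sub differentiableAt_id)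
        (hne1 w hwU))).mul (hF₀d w hwU)).differentiableWithinAt
  · intro p hp
    rw [Finset.mem_singleton] at hp
    subst hp
    refine ⟨fun w ↦ (w * kadiriP w - 1 - w / (1 - w)) * fordLaplace₀ f (s - w), U,
      hUopen.mem_nhds ⟨by simp, by simp; linarith⟩, ?_, ?_, ?_⟩
    · intro w hw
      refine ((((differentiableAt_id.mul (hPd w hw)).sub (differentiableAt_const _)).sub
        (differentiableAt_id.div ((differentiableAt_const _).sub differentiableAt_id)
          (hne1 w hw))).mul (hF₀d w hw)).differentiableWithinAt
    · simp
    · intro z hz hz0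
      rw [kadiriQ]
      have h1 := hne1 z hz
      field_simp
      ring

/-- On the lines `Re w = ±1/2` and for `|Im w| ≥ 2` on the strip: the scalar factor of `Q_s` is
`≤ log(3 + |Im w|) + 8 + ‖1/w‖ + ‖1/(1−w)‖`. [folklore] -/
theorem norm_kadiriP_sub_le {w : ℂ} (h1 : -(1 / 2) ≤ w.re) (h2 : w.re ≤ 1 / 2) :
    ‖kadiriP w - 1 / w - 1 / (1 - w)‖ ≤ Real.log (3 + |w.im|) + 8 + ‖1 / w‖ + ‖1 / (1 - w)‖ := by
  have h3 : ‖kadiriP w - 1 / w‖ ≤ ‖kadiriP w‖ + ‖1 / w‖ := norm_sub_le _ _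
  have h4 := norm_kadiriP_le h1 h2
  have h5 : ‖kadiriP w - 1 / w - 1 / (1 - w)‖ ≤ ‖kadiriP w - 1 / w‖ + ‖1 / (1 - w)‖ :=
    norm_sub_le _ _
  linarith

/-- `‖1/w‖ ≤ 2` and `‖1/(1 − w)‖ ≤ 2` on the lines `Re w = ±1/2`. [folklore] -/
theorem norm_inv_le_two_of_re {w : ℂ} (hw : w.re = 1 / 2 ∨ w.re = -(1 / 2)) :
    ‖1 / w‖ ≤ 2 ∧ ‖1 / (1 - w)‖ ≤ 2 := by
  have hre : (1 / 2 : ℝ) ≤ |w.re| := by rcases hw with h | h <;> norm_num [h]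
  have hre' : (1 / 2 : ℝ) ≤ |(1 - w).re| := by
    rw [sub_re, one_re]
    rcases hw with h | h <;> norm_num [h]
  have hn : (1 / 2 : ℝ) ≤ ‖w‖ := hre.trans (Complex.abs_re_le_norm w)
  have hn' : (1 / 2 : ℝ) ≤ ‖1 - w‖ := hre'.trans (Complex.abs_re_le_norm _)
  constructor
  · rw [norm_div, norm_one, div_le_iff₀ (by linarith)]; linarith
  · rw [norm_div, norm_one, div_le_iff₀ (by linarith)]; linarith

/-- `Q_s` is continuous along the lines `Re w = ±1/2` (`Re s > 1/2`). [folklore] -/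
theorem continuous_kadiriQ_vertical (h : IsSmoothedEFTest f p p' p'' x₀) (hσ₁ : 1 / 2 < s.re)
    {a : ℝ} (ha : a = 1 / 2 ∨ a = -(1 / 2)) :
    Continuous fun y : ℝ ↦ kadiriQ f s ((a : ℂ) + y * I) := by
  set Lv : ℝ → ℂ := fun y : ℝ ↦ (a : ℂ) + y * I with hLv
  have hline : Continuous Lv := by rw [hLv]; fun_prop
  have hcomp : (fun y : ℝ ↦ kadiriQ f s ((a : ℂ) + y * I)) = kadiriQ f s ∘ Lv := rfl
  rw [hcomp]
  refine continuous_iff_continuousAt.2 fun y ↦ ContinuousAt.comp (x := y) ?_ hline.continuousAt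
  have hre : (Lv y).re = a := by simp [hLv]
  have hw0 : Lv y ≠ 0 := fun h0 ↦ by
    have := congrArg Complex.re h0; rw [hre] at this; rcases ha with h | h <;> simp [h] at this
  have hw1 : 1 - Lv y ≠ 0 := fun h0 ↦ by
    have := congrArg Complex.re h0
    rw [sub_re, one_re, hre] at this
    rcases ha with h | h <;> norm_num [h] at this
  have hws : s - Lv y ≠ 0 := fun h0 ↦ by
    have := congrArg Complex.re h0
    rw [sub_re, hre] at this
    rcases ha with h | h <;> (rw [h] at this; simp at this; linarith)
  have hP : DifferentiableAt ℂ kadiriP (Lv y) :=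
    differentiableAt_kadiriP (by rw [hre]; rcases ha with h | h <;> norm_num [h])
      (by rw [hre]; rcases ha with h | h <;> norm_num [h])
  have hd : DifferentiableAt ℂ (kadiriQ f s) (Lv y) := by
    change DifferentiableAt ℂ (fun w ↦ (kadiriP w - 1 / w - 1 / (1 - w)) * fordLaplace₀ f (s - w)) (Lv y)
    exact ((hP.sub ((differentiableAt_const _).div differentiableAt_id hw0)).sub
      ((differentiableAt_const _).div ((differentiableAt_const _).sub differentiableAt_id) hw1)).mul
      ((differentiableAt_fordLaplace₀ h.cont h.x₀_nonneg h.eq_zero hws).comp (Lv y)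
        ((differentiableAt_const _).sub differentiableAt_id))
  exact hd.continuousAt

/-- **`Q_s` is integrable on the lines `Re w = ±1/2`** (`Re s > 1/2`): the scalar factor is
`≤ C + 2 log(1 + |y|)` and `|F₀(s − w)| ≤ D/((σ − a)² + (t − y)²)`. [folklore] -/
theorem integrable_kadiriQ_vertical (h : IsSmoothedEFTest f p p' p'' x₀) (hσ₁ : 1 / 2 < s.re)
    {a : ℝ} (ha : a = 1 / 2 ∨ a = -(1 / 2)) :
    Integrable fun y : ℝ ↦ kadiriQ f s ((a : ℂ) + y * I) := by
  set D := decayConst p' p'' x₀ with hD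
  have hD0 : 0 ≤ D := decayConst_nonneg h.x₀_nonneg
  set b : ℝ := s.re - a with hb
  have hb0 : 0 < b := by rcases ha with h | h <;> (rw [hb, h]; linarith)
  set A : ℝ := Real.log 3 + 12 with hA
  have hA0 : 0 ≤ A := by have := Real.log_nonneg (by norm_num : (1 : ℝ) ≤ 3); positivity
  refine (((integrable_left_majorant' hA0 hb0 (t := s.im)).const_mul D)).mono'
    (continuous_kadiriQ_vertical h hσ₁ ha).aestronglyMeasurable (ae_of_all _ fun y ↦ ?_)
  set w : ℂ := (a : ℂ) + y * I with hw
  have hwre : w.re = a := by simp [hw]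
  have hwim : w.im = y := by simp [hw]
  have hsw_re : (s - w).re = b := by rw [sub_re, hwre]
  have hsw_im : (s - w).im = s.im - y := by rw [sub_im, hwim]
  have hsw : s - w ≠ 0 := fun h0 ↦ by
    have := congrArg Complex.re h0; rw [hsw_re, zero_re] at this; linarith
  have hnorm : ‖s - w‖ ^ 2 = b ^ 2 + (s.im - y) ^ 2 := by
    rw [Complex.sq_norm, Complex.normSq_apply, hsw_re, hsw_im]; ring
  have hF : ‖fordLaplace₀ f (s - w)‖ ≤ D / (b ^ 2 + (s.im - y) ^ 2) := by
    rw [← hnorm]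
    refine norm_fordLaplace₀_le h hsw (by rw [hsw_re]; linarith)
  obtain ⟨hi1, hi2⟩ := norm_inv_le_two_of_re (w := w) (by rw [hwre]; exact ha)
  have hscal : ‖kadiriP w - 1 / w - 1 / (1 - w)‖ ≤ A + 2 * Real.log (1 + |y|) := by
    have hP := norm_kadiriP_sub_le (w := w) (by rw [hwre]; rcases ha with h | h <;> norm_num [h])
      (by rw [hwre]; rcases ha with h | h <;> norm_num [h])
    rw [hwim] at hP
    have hlog : Real.log (3 + |y|) ≤ Real.log 3 + Real.log (1 + |y|) := by
      rw [← Real.log_mul (by norm_num) (by positivity)]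
      exact Real.log_le_log (by positivity) (by nlinarith [abs_nonneg y])
    have hlog0 : 0 ≤ Real.log (1 + |y|) := Real.log_nonneg (by linarith [abs_nonneg y])
    rw [hA]
    linarith
  have hscal0 : 0 ≤ A + 2 * Real.log (1 + |y|) := by
    have := Real.log_nonneg (by linarith [abs_nonneg y] : (1 : ℝ) ≤ 1 + |y|); positivity
  rw [kadiriQ, norm_mul]
  calc ‖kadiriP w - 1 / w - 1 / (1 - w)‖ * ‖fordLaplace₀ f (s - w)‖
      ≤ (A + 2 * Real.log (1 + |y|)) * (D / (b ^ 2 + (s.im - y) ^ 2)) :=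
        mul_le_mul hscal hF (norm_nonneg _) hscal0
    _ = D * ((A + 2 * Real.log (1 + |y|)) / (b ^ 2 + (s.im - y) ^ 2)) := by ring

/-- **The horizontal sides of the digamma shift are small**: for `|T| ≥ 2`, `|Im s| < |T|`,
`‖∫_{−1/2}^{1/2} Q_s(x + iT) dx‖ ≤ (log(3 + |T|) + 9) · D/(|T| − |Im s|)²`. [folklore] -/
theorem norm_integral_kadiriQ_horizontal_le (h : IsSmoothedEFTest f p p' p'' x₀) (hσ₁ : 1 / 2 < s.re)
    {T : ℝ} (hT : 2 ≤ |T|) (hsT : |s.im| < |T|) :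
    ‖∫ x : ℝ in (-(1 / 2) : ℝ)..(1 / 2), kadiriQ f s (x + T * I)‖ ≤
      (Real.log (3 + |T|) + 9) * (decayConst p' p'' x₀ / (|T| - |s.im|) ^ 2) := by
  set D := decayConst p' p'' x₀ with hD
  have hD0 : 0 ≤ D := decayConst_nonneg h.x₀_nonneg
  have hgap : 0 < |T| - |s.im| := by linarith
  have hbound : ∀ x ∈ Set.uIoc (-(1 / 2) : ℝ) (1 / 2), ‖kadiriQ f s (x + T * I)‖ ≤
      (Real.log (3 + |T|) + 9) * (D / (|T| - |s.im|) ^ 2) := by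
    intro x hx
    rw [Set.uIoc_of_le (by norm_num)] at hx
    set w : ℂ := (x : ℂ) + T * I with hw
    have hwre : w.re = x := by simp [hw]
    have hwim : w.im = T := by simp [hw]
    have him : |T| - |s.im| ≤ |(s - w).im| := by
      rw [sub_im, hwim]
      have := abs_sub_abs_le_abs_sub T s.im
      rw [abs_sub_comm] at this
      linarith
    have hnorm : |T| - |s.im| ≤ ‖s - w‖ := him.trans (Complex.abs_im_le_norm _)
    have hsw : s - w ≠ 0 := norm_pos_iff.1 (hgap.trans_le hnorm)
    have hF : ‖fordLaplace₀ f (s - w)‖ ≤ D / (|T| - |s.im|) ^ 2 := by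
      refine (norm_fordLaplace₀_le h hsw (by rw [sub_re, hwre]; linarith [hx.2])).trans ?_
      exact div_le_div_of_nonneg_left hD0 (by positivity) (by gcongr)
    have hnw : (2 : ℝ) ≤ ‖w‖ := hT.trans (by rw [← hwim]; exact Complex.abs_im_le_norm w)
    have hnw' : (2 : ℝ) ≤ ‖1 - w‖ := hT.trans (by
      have := Complex.abs_im_le_norm (1 - w); simpa [hwim] using this)
    have hi1 : ‖1 / w‖ ≤ 1 / 2 := by
      rw [norm_div, norm_one]; exact one_div_le_one_div_of_le two_pos hnw
    have hi2 : ‖1 / (1 - w)‖ ≤ 1 / 2 := by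
      rw [norm_div, norm_one]; exact one_div_le_one_div_of_le two_pos hnw'
    have hscal : ‖kadiriP w - 1 / w - 1 / (1 - w)‖ ≤ Real.log (3 + |T|) + 9 := by
      have hP := norm_kadiriP_sub_le (w := w) (by rw [hwre]; linarith [hx.1]) (by rw [hwre]; exact hx.2)
      rw [hwim] at hP
      linarith
    have hlog3 : 0 ≤ Real.log (3 + |T|) + 9 := by
      have := Real.log_nonneg (by linarith [abs_nonneg T] : (1 : ℝ) ≤ 3 + |T|); positivity
    rw [kadiriQ, norm_mul]
    exact mul_le_mul hscal hF (norm_nonneg _) hlog3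
  refine (intervalIntegral.norm_integral_le_of_norm_le_const hbound).trans_eq ?_
  norm_num

/-- **Shifting the digamma piece** (Kadiri 2005, (3.5): "déplaçons la droite d'intégration vers la
droite `σ = 1/2` … `lim I₃(T) = (1/2iπ) lim ∫_{1/2−iT}^{1/2+iT} Re Γ'/Γ((s+𝔞)/2) Φ(−s) ds + (1−𝔞)Φ(0)`"):
for `Re s > 1/2`,
`∫_ℝ Q_s(−1/2 + iy) dy = ∫_ℝ Q_s(1/2 + iy) dy + 2π F₀(s)` (the residue `−F₀(s)` at `w = 0`; the
horizontal sides are `O(log T/T²)`, no good heights needed). [cite: Kadiri2005, (3.5)] -/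
theorem integral_kadiriQ_left_eq (h : IsSmoothedEFTest f p p' p'' x₀) (hσ₁ : 1 / 2 < s.re) :
    ∫ y : ℝ, kadiriQ f s ((((-(1 / 2) : ℝ)) : ℂ) + y * I) =
      (∫ y : ℝ, kadiriQ f s ((((1 / 2 : ℝ)) : ℂ) + y * I)) + 2 * π * fordLaplace₀ f s := by
  set D := decayConst p' p'' x₀ with hD
  have hD0 : 0 ≤ D := decayConst_nonneg h.x₀_nonneg
  set Lft := ∫ y : ℝ, kadiriQ f s ((((-(1 / 2) : ℝ)) : ℂ) + y * I) with hLft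
  set Rgt := ∫ y : ℝ, kadiriQ f s ((((1 / 2 : ℝ)) : ℂ) + y * I) with hRgt
  -- heights `T_N = N`
  have hTtop : Tendsto (fun N : ℕ ↦ (N : ℝ)) atTop atTop := tendsto_natCast_atTop_atTop
  obtain ⟨N₀, hN₀⟩ := exists_nat_gt (2 * |s.im| + 2)
  have hbig : ∀ N : ℕ, max N₀ 2 ≤ N → (2 : ℝ) ≤ N ∧ |s.im| + 1 < N ∧ (N : ℝ) / 2 ≤ N - |s.im| := by
    intro N hN
    have hN2 : (2 : ℝ) ≤ N := by exact_mod_cast le_of_max_le_right hN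
    have hNN₀ : (N₀ : ℝ) ≤ N := by exact_mod_cast le_of_max_le_left hN
    refine ⟨hN2, by linarith [abs_nonneg s.im], by linarith [abs_nonneg s.im]⟩
  -- (1) horizontal sides
  have hhor0 : ∀ sgn : ℝ, (sgn = 1 ∨ sgn = -1) →
      Tendsto (fun N : ℕ ↦ ∫ x : ℝ in (-(1 / 2) : ℝ)..(1 / 2),
        kadiriQ f s (x + ((sgn * N : ℝ) : ℂ) * I)) atTop (𝓝 0) := by
    intro sgn hsgn
    refine squeeze_zero_norm' ?_
      (by simpa using ((ZetaZeroSum.tendsto_log_sq_div.const_mul (10 * (D * 4)))))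
    filter_upwards [eventually_ge_atTop (max N₀ 2)] with N hN
    obtain ⟨hN2, hsN, hgapN⟩ := hbig N hN
    have hTabs : |sgn * (N : ℝ)| = N := by
      rcases hsgn with rfl | rfl <;> simp
    have hbd := norm_integral_kadiriQ_horizontal_le h hσ₁ (T := sgn * N)
      (by rw [hTabs]; exact hN2) (by rw [hTabs]; linarith)
    rw [hTabs] at hbd
    refine hbd.trans ?_
    set ℓ := Real.log ((N : ℝ) + 7) with hℓ
    have hℓ1 : 1 ≤ ℓ := by
      rw [hℓ, Real.le_log_iff_exp_le (by positivity)]; linarith [Real.exp_one_lt_d9]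
    have hlog3 : Real.log (3 + (N : ℝ)) ≤ ℓ := Real.log_le_log (by positivity) (by linarith)
    have hlog30 : 0 ≤ Real.log (3 + (N : ℝ)) := Real.log_nonneg (by linarith)
    have hN0 : (0 : ℝ) < N := by linarith
    have e1 : Real.log (3 + (N : ℝ)) + 9 ≤ 10 * ℓ ^ 2 := by nlinarith
    have hsq : ((N : ℝ) / 2) ^ 2 ≤ ((N : ℝ) - |s.im|) ^ 2 := pow_le_pow_left₀ (by positivity) hgapN 2
    have hsq' : (N : ℝ) / 4 ≤ ((N : ℝ) - |s.im|) ^ 2 := by nlinarith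
    have e2 : D / ((N : ℝ) - |s.im|) ^ 2 ≤ D * 4 / N :=
      (div_le_div_of_nonneg_left hD0 (by positivity) hsq').trans_eq (by rw [div_div_eq_mul_div])
    have hlhs0 : 0 ≤ Real.log (3 + (N : ℝ)) + 9 := by positivity
    calc (Real.log (3 + (N : ℝ)) + 9) * (D / ((N : ℝ) - |s.im|) ^ 2)
        ≤ 10 * ℓ ^ 2 * (D * 4 / N) := mul_le_mul e1 e2 (by positivity) (by positivity)
      _ = 10 * (D * 4) * (ℓ ^ 2 / N) := by ring
  -- (2) vertical sides
  have hvert : ∀ a : ℝ, (a = 1 / 2 ∨ a = -(1 / 2)) →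
      Tendsto (fun N : ℕ ↦ ∫ y : ℝ in (-(N : ℝ))..N, kadiriQ f s ((a : ℂ) + y * I)) atTop
        (𝓝 (∫ y : ℝ, kadiriQ f s ((a : ℂ) + y * I))) := fun a ha ↦
    intervalIntegral_tendsto_integral (integrable_kadiriQ_vertical h hσ₁ ha)
      (tendsto_neg_atTop_atBot.comp hTtop) hTtop
  have hright := hvert (1 / 2) (Or.inl rfl)
  have hleft := hvert (-(1 / 2)) (Or.inr rfl)
  -- (3) the boundary integral and its two evaluations
  have hlim1 : Tendsto (fun N : ℕ ↦
      Literature.Analysis.Complex.rectBoundaryIntegral (kadiriQ f s) (-(1 / 2)) (1 / 2) (-(N : ℝ)) N)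
      atTop (𝓝 (0 - 0 + I * Rgt - I * Lft)) := by
    have hb := hhor0 (-1) (Or.inr rfl)
    have ht := hhor0 1 (Or.inl rfl)
    simp only [neg_mul, one_mul] at hb ht
    have := ((hb.sub ht).add (hright.const_mul I)).sub (hleft.const_mul I)
    refine this.congr fun N ↦ ?_
    simp only [Literature.Analysis.Complex.rectBoundaryIntegral]
  have hid : ∀ᶠ N : ℕ in atTop,
      Literature.Analysis.Complex.rectBoundaryIntegral (kadiriQ f s) (-(1 / 2)) (1 / 2) (-(N : ℝ)) N =
        2 * π * I * (-fordLaplace₀ f s) := by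
    filter_upwards [eventually_ge_atTop (max N₀ 2)] with N hN
    obtain ⟨hN2, -, -⟩ := hbig N hN
    exact rectBoundaryIntegral_kadiriQ h hσ₁ (by linarith)
  have hlim2 : Tendsto (fun N : ℕ ↦
      Literature.Analysis.Complex.rectBoundaryIntegral (kadiriQ f s) (-(1 / 2)) (1 / 2) (-(N : ℝ)) N)
      atTop (𝓝 (2 * π * I * (-fordLaplace₀ f s))) :=
    tendsto_const_nhds.congr' (hid.mono fun N hN ↦ hN.symm)
  have heq := tendsto_nhds_unique hlim1 hlim2
  have key : I * (Lft - Rgt - 2 * π * fordLaplace₀ f s) = 0 := by linear_combination -heq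
  rcases mul_eq_zero.1 key with hI | hI
  · exact absurd hI I_ne_zero
  · linear_combination hI

end digammaShift

/-! ## The functional equation on `Re w = −1/2` and the assembly -/

section assembly

variable {s : ℂ}

/-- **The functional equation for `ζ'/ζ` on the left line**, in the shifted-digamma form: for
`w = −1/2 + iy`,
`−ζ'/ζ(w) = −(Σ Λ(n) n^{−(1−w)}) − log π + (P(w) − 1/w − 1/(1−w))`
(`ζ'/ζ(w) = ξ'/ξ(w) − 1/w − 1/(w−1) − Γ_ℝ'/Γ_ℝ(w)`, `ξ'/ξ(w) = −ξ'/ξ(1−w)`, the same at `1 − w`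
where `Re = 3/2` and `ζ'/ζ = −Σ Λ n^{-s}`, and `Γ_ℝ'/Γ_ℝ(w) = −½log π + ½ψ(w/2+1) − 1/w`).
[cite: Kadiri2005, Thm. 3.1 (proof: the functional equation of L)] -/
theorem neg_logDeriv_zeta_left_line (y : ℝ) :
    -(deriv riemannZeta ((((-(1 / 2) : ℝ)) : ℂ) + y * I) / riemannZeta ((((-(1 / 2) : ℝ)) : ℂ) + y * I)) =
      -LSeries (fun n ↦ ((ArithmeticFunction.vonMangoldt n : ℝ) : ℂ)) ((((3 / 2 : ℝ)) : ℂ) - y * I)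
        - Complex.log π + (kadiriP ((((-(1 / 2) : ℝ)) : ℂ) + y * I)
          - 1 / ((((-(1 / 2) : ℝ)) : ℂ) + y * I) - 1 / (1 - ((((-(1 / 2) : ℝ)) : ℂ) + y * I))) := by
  set w : ℂ := (((-(1 / 2) : ℝ)) : ℂ) + y * I with hw
  have hwre : w.re = -(1 / 2) := by simp [hw]
  have h1w : 1 - w = (((3 / 2 : ℝ)) : ℂ) - y * I := by rw [hw]; push_cast; ring
  have hw0 : w ≠ 0 := fun h ↦ by have := congrArg Complex.re h; rw [hwre] at this; norm_num at this
  have hw1 : w ≠ 1 := fun h ↦ by have := congrArg Complex.re h; rw [hwre] at this; norm_num at this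
  have h1wre : (1 - w).re = 3 / 2 := by rw [sub_re, one_re, hwre]; norm_num
  have h1w0 : 1 - w ≠ 0 := fun h ↦ by have := congrArg Complex.re h; rw [h1wre] at this; norm_num at this
  have h1w1 : 1 - w ≠ 1 := fun h ↦ hw0 (by linear_combination -h)
  have hζ : riemannZeta w ≠ 0 := PsiOneExplicit.riemannZeta_left_ne_zero y
  have hζ' : riemannZeta (1 - w) ≠ 0 := riemannZeta_ne_zero_of_one_lt_re (by rw [h1wre]; norm_num)
  have A := PsiOneExplicit.logDeriv_riemannZeta_eq_logDeriv_riemannXi (s := w)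
    (by rw [hwre]; norm_num) hw0 hw1 hζ
  have B := PsiOneExplicit.logDeriv_riemannZeta_eq_logDeriv_riemannXi (s := 1 - w)
    (by rw [h1wre]; norm_num) h1w0 h1w1 hζ'
  have C := logDeriv_riemannXi_one_sub w
  have D := PsiOneExplicit.logDeriv_Gammaℝ_eq_shift (s := w) (by rw [hwre]; norm_num) hw0
  have E := PsiOneExplicit.logDeriv_Gammaℝ_eq_shift (s := 1 - w) (by rw [h1wre]; norm_num) h1w0
  have F := ArithmeticFunction.LSeries_vonMangoldt_eq_deriv_riemannZeta_div (s := 1 - w)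
    (by rw [h1wre]; norm_num)
  rw [← h1w]
  have e1 : (1 : ℂ) / (1 - w - 1) = -(1 / w) := by
    rw [show (1 : ℂ) - w - 1 = -w by ring, one_div_neg_eq_neg_one_div]
  have e2 : (1 : ℂ) / (w - 1) = -(1 / (1 - w)) := by
    rw [show w - 1 = -(1 - w) by ring, one_div_neg_eq_neg_one_div]
  rw [e1] at B
  rw [e2] at A
  rw [kadiriP]
  linear_combination (-1 : ℂ) * A - B - C + D + E + F

/-- On the left line the integrand splits into the three pieces. [folklore] -/
theorem smoothedEFIntegrand_left_eq (f : ℝ → ℝ) (s : ℂ) (y : ℝ) :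
    smoothedEFIntegrand f s ((((-(1 / 2) : ℝ)) : ℂ) + y * I) =
      -(LSeries (fun n ↦ ((ArithmeticFunction.vonMangoldt n : ℝ) : ℂ)) ((((3 / 2 : ℝ)) : ℂ) - y * I) *
          fordLaplace₀ f (s - ((((-(1 / 2) : ℝ)) : ℂ) + y * I)))
        - Complex.log π * fordLaplace₀ f (s - ((((-(1 / 2) : ℝ)) : ℂ) + y * I))
        + kadiriQ f s ((((-(1 / 2) : ℝ)) : ℂ) + y * I) := by
  rw [smoothedEFIntegrand, neg_logDeriv_zeta_left_line, kadiriQ]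
  ring

/-- On the right line `Re w = 1/2`: `P(w) − 1/w − 1/(1−w) = ½[ψ(w/2) + ψ((1−w)/2)] = Re ψ(w/2)`
(`ψ(z+1) = ψ(z) + 1/z`; `(1−w)/2 = conj(w/2)` and `ψ(z̄) = conj ψ(z)`).
[cite: Kadiri2005, Thm. 3.1 (proof, display before (3.5))] -/
theorem kadiriP_sub_right_line (y : ℝ) :
    kadiriP ((((1 / 2 : ℝ)) : ℂ) + y * I) - 1 / ((((1 / 2 : ℝ)) : ℂ) + y * I)
        - 1 / (1 - ((((1 / 2 : ℝ)) : ℂ) + y * I)) =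
      ((digamma (((((1 / 2 : ℝ)) : ℂ) + y * I) / 2)).re : ℂ) := by
  set w : ℂ := (((1 / 2 : ℝ)) : ℂ) + y * I with hw
  set z : ℂ := w / 2 with hz
  have hzre : z.re = 1 / 4 := by simp [hz, hw]; norm_num
  have hconj : (1 - w) / 2 = conj z := by
    apply Complex.ext
    · rw [Complex.conj_re]
      simp [hz, hw]
      norm_num
    · rw [Complex.conj_im]
      simp [hz, hw]
      ring
  have hpole : ∀ m : ℕ, z ≠ -m := by
    intro m h
    have := congrArg Complex.re h
    rw [hzre] at this
    simp at this
    linarith [(m.cast_nonneg : (0 : ℝ) ≤ m)]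
  have hpole' : ∀ m : ℕ, conj z ≠ -m := by
    intro m h
    have := congrArg Complex.re h
    rw [Complex.conj_re, hzre] at this
    simp at this
    linarith [(m.cast_nonneg : (0 : ℝ) ≤ m)]
  have h1 : digamma (z + 1) = digamma z + z⁻¹ := Complex.digamma_apply_add_one z hpole
  have h2 : digamma (conj z + 1) = digamma (conj z) + (conj z)⁻¹ :=
    Complex.digamma_apply_add_one (conj z) hpole'
  have h3 : digamma (conj z) = conj (digamma z) := digamma_conj z
  have hwz : w = 2 * z := by rw [hz]; ring
  have h1w : 1 - w = 2 * conj z := by rw [← hconj]; ring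
  rw [kadiriP, show w / 2 = z from rfl, hconj, h1, h2, h3, h1w, hwz]
  have hz0 : z ≠ 0 := fun h ↦ by have := congrArg Complex.re h; rw [hzre] at this; norm_num at this
  have hcz0 : conj z ≠ 0 := fun h ↦ hz0 (by simpa using congrArg conj h)
  rw [Complex.re_eq_add_conj]
  field_simp
  ring

/-- `Q_s` on the right line is `Re ψ(w/2) · F₀(s − w)`. [folklore] -/
theorem kadiriQ_right_line (f : ℝ → ℝ) (s : ℂ) (y : ℝ) :
    kadiriQ f s ((((1 / 2 : ℝ)) : ℂ) + y * I) =
      ((digamma (((((1 / 2 : ℝ)) : ℂ) + y * I) / 2)).re : ℂ) *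
        fordLaplace₀ f (s - ((((1 / 2 : ℝ)) : ℂ) + y * I)) := by
  rw [kadiriQ, kadiriP_sub_right_line]

/-- **The remainder in Kadiri's form** (Kadiri 2005, Thm. 3.1 for `q = 1` and her
`φ(y) = (f(0) − f(y))e^{−ys}`: "`+ φ(0) log(q/π) + Σ Λ(n)χ̄(n)/n φ(−log n)
+ lim (1/2iπ)∫_{1/2−iT}^{1/2+iT} Re Γ'/Γ((s+𝔞)/2) Φ(−s) ds`" with "`(1 − 𝔞)Φ(0)`" from (3.5)):
for an admissible smoothing and `1/2 < Re s`,
`J(s) = F₀(s) + (1/2π) ∫_ℝ Re ψ((1/2 + iy)/2) · F₀(s − 1/2 − iy) dy`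
(Kadiri's `T₂` before taking real parts: `Φ(0) = −F₂(s)/s² = −F₀(s)` for her `φ`, and
`Φ(−z) = −F₀(s − z)`). [cite: Kadiri2005, Thm. 3.1 and (3.3)–(3.5)] -/
theorem smoothedEFRemainder_eq_kadiri (h : IsSmoothedEFTest f p p' p'' x₀) (hσ₁ : 1 / 2 < s.re) :
    smoothedEFRemainder f s = fordLaplace₀ f s + (1 / (2 * π) : ℂ) *
      ∫ y : ℝ, ((digamma (((((1 / 2 : ℝ)) : ℂ) + y * I) / 2)).re : ℂ) *
        fordLaplace₀ f (s - ((((1 / 2 : ℝ)) : ℂ) + y * I)) := by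
  have hσ₁' : -(1 / 2) < s.re := by linarith
  obtain ⟨hLint, hLval⟩ := integral_LSeries_dual_mul_fordLaplace₀_eq_zero h hσ₁'
  have hFint : Integrable fun y : ℝ ↦ fordLaplace₀ f (s - ((((-(1 / 2) : ℝ)) : ℂ) + y * I)) := by
    have hc0 : 0 < s.re + 1 / 2 := by linarith
    have hint := integrable_vertical h hc0.ne'
    have harg : ∀ y : ℝ, s - ((((-(1 / 2) : ℝ)) : ℂ) + y * I) =
        ((s.re + 1 / 2 : ℝ) : ℂ) + ((s.im - y : ℝ) : ℂ) * I := by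
      intro y; apply Complex.ext <;> simp
    simp_rw [harg]
    exact hint.comp_sub_left s.im
  have hFval := integral_fordLaplace₀_left_eq_zero h hσ₁'
  have hQint := integrable_kadiriQ_vertical h hσ₁ (a := -(1 / 2)) (Or.inr rfl)
  have hQval := integral_kadiriQ_left_eq h hσ₁
  have hN : Integrable fun y : ℝ ↦
      -(LSeries (fun n ↦ ((ArithmeticFunction.vonMangoldt n : ℝ) : ℂ)) ((((3 / 2 : ℝ)) : ℂ) - y * I) *
        fordLaplace₀ f (s - ((((-(1 / 2) : ℝ)) : ℂ) + y * I))) := hLint.neg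
  have hC : Integrable fun y : ℝ ↦ Complex.log π * fordLaplace₀ f (s - ((((-(1 / 2) : ℝ)) : ℂ) + y * I)) :=
    hFint.const_mul _
  have hA : Integrable fun y : ℝ ↦
      -(LSeries (fun n ↦ ((ArithmeticFunction.vonMangoldt n : ℝ) : ℂ)) ((((3 / 2 : ℝ)) : ℂ) - y * I) *
        fordLaplace₀ f (s - ((((-(1 / 2) : ℝ)) : ℂ) + y * I)))
      - Complex.log π * fordLaplace₀ f (s - ((((-(1 / 2) : ℝ)) : ℂ) + y * I)) := hN.sub hC
  rw [smoothedEFRemainder]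
  simp_rw [smoothedEFIntegrand_left_eq]
  rw [integral_add hA hQint, integral_sub hN hC, integral_neg, integral_const_mul, hLval, hFval]
  have hQval' : ∫ y : ℝ, kadiriQ f s ((((-(1 / 2) : ℝ)) : ℂ) + y * I) =
      (∫ y : ℝ, ((digamma (((((1 / 2 : ℝ)) : ℂ) + y * I) / 2)).re : ℂ) *
        fordLaplace₀ f (s - ((((1 / 2 : ℝ)) : ℂ) + y * I))) + 2 * π * fordLaplace₀ f s := by
    rw [hQval]
    simp_rw [kadiriQ_right_line]
  rw [hQval']
  set R := ∫ y : ℝ, ((digamma (((((1 / 2 : ℝ)) : ℂ) + y * I) / 2)).re : ℂ) *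
    fordLaplace₀ f (s - ((((1 / 2 : ℝ)) : ℂ) + y * I)) with hR
  have hπ : (π : ℂ) ≠ 0 := ofReal_ne_zero.2 Real.pi_ne_zero
  field_simp
  ring

/-- **The smoothed explicit formula in Kadiri's form** (Kadiri 2005, (2.2) = Prop. 2.1 before real
parts: "`Re Σ Λ(n) n^{-s} f(log n) = f(0) Re(Σ Λ(n)n^{-s} − 1/(s−1) + Σ_ρ 1/(s−ρ)) + Re F(s−1)
− Σ_ρ Re F(s−ρ) + Re((1/2iπ)∫_{(1/2)} Re Γ'/Γ(z/2) F₂(s−z)/(s−z)² dz + F₂(s)/s²)`", here with the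
zeros counted with multiplicity and `F₀ = F − f(0)/z` in place of `F₂/z²` — equal for her
`(H₁)` test functions, `fordLaplace₀_eq_of_C2` with `p'(0) = 0`): for an admissible smoothing and
`1/2 < Re s < 3/2`, `s ≠ 1`, `ζ(s) ≠ 0`,
`K_f(s) = −f(0)ζ'/ζ(s) + F₀(s−1) − Σ_ρ m(ρ)F₀(s−ρ) + F₀(s) + (1/2π)∫_ℝ Re ψ((1/2+iy)/2) F₀(s−1/2−iy) dy`.
[cite: Kadiri2005, Prop. 2.1 and (2.2)] -/
theorem fordK_eq_explicit_kadiri (h : IsSmoothedEFTest f p p' p'' x₀) (hσ₁ : 1 / 2 < s.re)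
    (hσ₂ : s.re < 3 / 2) (hs1 : s ≠ 1) (hζs : riemannZeta s ≠ 0) :
    fordK f s = -(f 0 : ℂ) * (deriv riemannZeta s / riemannZeta s) + fordLaplace₀ f (s - 1) -
      ∑' ρ : RHWave0.riemannZetaNontrivialZeros,
        (riemannZetaZeroOrder (ρ : ℂ) : ℂ) * fordLaplace₀ f (s - ρ) +
      (fordLaplace₀ f s + (1 / (2 * π) : ℂ) *
        ∫ y : ℝ, ((digamma (((((1 / 2 : ℝ)) : ℂ) + y * I) / 2)).re : ℂ) *
          fordLaplace₀ f (s - ((((1 / 2 : ℝ)) : ℂ) + y * I))) := by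
  rw [← smoothedEFRemainder_eq_kadiri h hσ₁]
  exact fordK_eq_explicit h (by linarith) hσ₂ hs1 hζs

end assembly

end SmoothedEF

end Literature.NumberTheory.LFunctions
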